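import Mathlib
import HarnessLib

/-!
# The RH-free polynomial lemma `JointPoly` (cell rh-split, glue of the X-4 «DERIVATIVE–LAGUERRE» splitting)

**Theorem** (`splits_of_derivative_splits_of_laguerre`). If `p : ℝ[X]` has a real-rooted derivative and every
critical point of `p` that is not a zero of `p` satisfies the strict Laguerre sign law `p(x)·p″(x) < 0`, then `p`
is real-rooted (`p.Splits`). This is the statement `JointPoly` of the cell card cards/SPLIT-jen-neg.md §3
(seat rh-split-jen-neg; «TRUE — proof on the card, not yet kernel»), now kernel-checked; pure Mathlib, standard axioms,
no named fact. It is consumed by `Theorems/Splittings/DerivativeLaguerre.lean`.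

Proof. (1) At a root `a` of a polynomial `q`, `q = (X − a)·r` with `r(a) = q′(a)`, so one-sided positivity of `q`
next to `a` fixes the sign of `q′(a)` (`derivative_nonneg_of_pos_right`, `derivative_nonpos_of_pos_left`); applied to
`q = p′` at two consecutive non-root critical points `a < b` with `p′ > 0` between, the sign law gives
`p(a) < 0 < p(b)`, hence a root of `p` in `(a, b)` (IVT; `exists_root_Ioo`); beyond the last / before the first critical
point the same local sign plus `strictMonoOn_of_deriv_pos` and the leading-term asymptotics give a root on each ray
(`exists_root_Ioi`, `exists_root_Iio`, the latter through `p.comp (−X)`). (2) With sentinels `±M` beyond all roots and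
critical points, `Finset.card_le_sdiff_of_interleaved` turns (1) into `#(distinct roots of p) ≥ #(non-root critical
points) + 1`. (3) Multiplicities: `mult_p(z) = mult_{p′}(z) + 1` at every root (`derivative_rootMultiplicity_of_root`)
and `mult_{p′}(c) = 1` at non-root critical points (`p″(c) ≠ 0`), so `p.roots.card ≥ natDegree p`, i.e. `p.Splits`
(`splits_iff_card_roots`). Typed by rh-split-typer-2. Nothing here bears on the truth of RH.
-/

open Polynomial Set Filter Topology

set_option linter.dupNamespace false

namespace Summit.RiemannHypothesis.RiemannHypothesis.Theorems.Splittings.JointPoly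

/-! ### Local sign of a polynomial next to a root, from the first non-vanishing derivative -/

/-- Factor a root: `q(x) = (x − a) · (q /ₘ (X − a))(x)`. [folklore] -/
theorem eval_eq_sub_mul_divByMonic (q : ℝ[X]) {a : ℝ} (ha : q.eval a = 0) (x : ℝ) :
    q.eval x = (x - a) * (q /ₘ (X - C a)).eval x := by
  have h : (X - C a) * (q /ₘ (X - C a)) = q := mul_divByMonic_eq_iff_isRoot.2 ha
  conv_lhs => rw [← h]
  simp

/-- At a root `a` of `q`: `q'(a) = (q /ₘ (X − a))(a)`. [folklore] -/
theorem eval_derivative_eq_divByMonic (q : ℝ[X]) {a : ℝ} (ha : q.eval a = 0) :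
    (derivative q).eval a = (q /ₘ (X - C a)).eval a := by
  have h : (X - C a) * (q /ₘ (X - C a)) = q := mul_divByMonic_eq_iff_isRoot.2 ha
  conv_lhs => rw [← h]
  simp [derivative_mul]

/-- If `q(a) = 0` and `q > 0` immediately to the RIGHT of `a`, then `q'(a) ≥ 0`. [folklore] -/
theorem derivative_nonneg_of_pos_right (q : ℝ[X]) {a b : ℝ} (hab : a < b) (ha : q.eval a = 0)
    (hpos : ∀ x ∈ Ioo a b, 0 < q.eval x) : 0 ≤ (derivative q).eval a := by
  by_contra hneg
  push Not at hneg
  set r := q /ₘ (X - C a) with hr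
  have hra : r.eval a < 0 := by rwa [← eval_derivative_eq_divByMonic q ha]
  have hev : ∀ᶠ x in 𝓝 a, r.eval x < 0 := r.continuous.continuousAt.eventually_lt_const hra
  obtain ⟨ε, hε, hball⟩ := Metric.eventually_nhds_iff.1 hev
  set x := a + min (ε / 2) ((b - a) / 2) with hx
  have hx1 : a < x := by have : 0 < min (ε / 2) ((b - a) / 2) := lt_min (by linarith) (by linarith); linarith
  have hx2 : x < b := by have : min (ε / 2) ((b - a) / 2) ≤ (b - a) / 2 := min_le_right _ _; linarith
  have hx3 : dist x a < ε := by
    rw [Real.dist_eq, abs_of_pos (by linarith)]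
    have : min (ε / 2) ((b - a) / 2) ≤ ε / 2 := min_le_left _ _; linarith
  have h1 : r.eval x < 0 := hball hx3
  have h2 : 0 < q.eval x := hpos x ⟨hx1, hx2⟩
  rw [eval_eq_sub_mul_divByMonic q ha x] at h2
  have : 0 < x - a := by linarith
  nlinarith

/-- If `q(b) = 0` and `q > 0` immediately to the LEFT of `b`, then `q'(b) ≤ 0`. [folklore] -/
theorem derivative_nonpos_of_pos_left (q : ℝ[X]) {a b : ℝ} (hab : a < b) (hb : q.eval b = 0)
    (hpos : ∀ x ∈ Ioo a b, 0 < q.eval x) : (derivative q).eval b ≤ 0 := by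
  by_contra hposd
  push Not at hposd
  set r := q /ₘ (X - C b) with hr
  have hrb : 0 < r.eval b := by rwa [← eval_derivative_eq_divByMonic q hb]
  have hev : ∀ᶠ x in 𝓝 b, 0 < r.eval x := r.continuous.continuousAt.eventually_const_lt hrb
  obtain ⟨ε, hε, hball⟩ := Metric.eventually_nhds_iff.1 hev
  set x := b - min (ε / 2) ((b - a) / 2) with hx
  have hx1 : x < b := by have : 0 < min (ε / 2) ((b - a) / 2) := lt_min (by linarith) (by linarith); linarith
  have hx2 : a < x := by have : min (ε / 2) ((b - a) / 2) ≤ (b - a) / 2 := min_le_right _ _; linarith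
  have hx3 : dist x b < ε := by
    rw [Real.dist_eq, abs_of_neg (by linarith)]
    have : min (ε / 2) ((b - a) / 2) ≤ ε / 2 := min_le_left _ _; linarith
  have h1 : 0 < r.eval x := hball hx3
  have h2 : 0 < q.eval x := hpos x ⟨hx2, hx1⟩
  rw [eval_eq_sub_mul_divByMonic q hb x] at h2
  have : x - b < 0 := by linarith
  nlinarith

/-! ### Constant sign of `p'` on a critical-point-free interval -/

/-- A polynomial with no zero on an order-connected set has constant sign there. [folklore] -/
theorem pos_or_neg_of_forall_ne_zero (q : ℝ[X]) {S : Set ℝ} (hS : S.OrdConnected)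
    (hno : ∀ x ∈ S, q.eval x ≠ 0) : (∀ x ∈ S, 0 < q.eval x) ∨ (∀ x ∈ S, q.eval x < 0) := by
  by_contra h
  rw [not_or] at h
  obtain ⟨⟨x, hx, hxle⟩, ⟨y, hy, hyle⟩⟩ := And.intro (not_forall₂.1 h.1) (not_forall₂.1 h.2)
  -- `hxle : ¬ 0 < q x`, `hyle : ¬ q y < 0`
  have hqx : q.eval x < 0 := lt_of_le_of_ne (not_lt.1 hxle) (hno x hx)
  have hqy : 0 < q.eval y := lt_of_le_of_ne (not_lt.1 hyle) (fun h ↦ hno y hy h.symm)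
  have hsub : uIcc x y ⊆ S := hS.uIcc_subset hx hy
  have hivt := intermediate_value_uIcc (a := x) (b := y) (f := fun t ↦ q.eval t) q.continuousOn
  have h0 : (0 : ℝ) ∈ uIcc (q.eval x) (q.eval y) := by
    rw [mem_uIcc]; left; exact ⟨hqx.le, hqy.le⟩
  obtain ⟨z, hz, hz0⟩ := hivt h0
  exact hno z (hsub hz) hz0

/-! ### A root of `p` between two consecutive non-root critical points -/

/-- The sign pattern at the two ends: if `p' > 0` on `(a,b)` with `p'(a) = p'(b) = 0` and the Laguerre sign law
holds at `a` and `b` (off the zeros of `p`), then `p(a) < 0 < p(b)`. [folklore] -/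
theorem sign_ends_of_pos {p : ℝ[X]} {a b : ℝ} (hab : a < b) (ha : (derivative p).eval a = 0)
    (hb : (derivative p).eval b = 0)
    (hsa : p.eval a * (derivative (derivative p)).eval a < 0)
    (hsb : p.eval b * (derivative (derivative p)).eval b < 0)
    (hpos : ∀ x ∈ Ioo a b, 0 < (derivative p).eval x) : p.eval a < 0 ∧ 0 < p.eval b := by
  have h2a : 0 ≤ (derivative (derivative p)).eval a := derivative_nonneg_of_pos_right _ hab ha hpos
  have h2b : (derivative (derivative p)).eval b ≤ 0 := derivative_nonpos_of_pos_left _ hab hb hpos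
  constructor
  · by_contra h; push Not at h; nlinarith
  · by_contra h; push Not at h; nlinarith

/-- Between two consecutive critical points `a < b` that are not roots of `p`, the sign law forces a root of `p`
in `(a, b)`. [folklore] -/
theorem exists_root_Ioo {p : ℝ[X]} {a b : ℝ} (hab : a < b) (ha : (derivative p).eval a = 0)
    (hb : (derivative p).eval b = 0)
    (hsa : p.eval a * (derivative (derivative p)).eval a < 0)
    (hsb : p.eval b * (derivative (derivative p)).eval b < 0)
    (hno : ∀ x ∈ Ioo a b, (derivative p).eval x ≠ 0) : ∃ z ∈ Ioo a b, p.eval z = 0 := by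
  rcases pos_or_neg_of_forall_ne_zero (derivative p) ordConnected_Ioo hno with hpos | hneg
  · obtain ⟨h1, h2⟩ := sign_ends_of_pos hab ha hb hsa hsb hpos
    have := intermediate_value_Ioo hab.le (f := fun t ↦ p.eval t) p.continuousOn (⟨h1, h2⟩ : (0:ℝ) ∈ Ioo _ _)
    exact this
  · -- apply the positive case to `-p`
    have hpos : ∀ x ∈ Ioo a b, 0 < (derivative (-p)).eval x := fun x hx ↦ by
      simpa using hneg x hx
    have ha' : (derivative (-p)).eval a = 0 := by simpa using ha
    have hb' : (derivative (-p)).eval b = 0 := by simpa using hb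
    have hsa' : (-p).eval a * (derivative (derivative (-p))).eval a < 0 := by simpa using hsa
    have hsb' : (-p).eval b * (derivative (derivative (-p))).eval b < 0 := by simpa using hsb
    obtain ⟨h1, h2⟩ := sign_ends_of_pos hab ha' hb' hsa' hsb' hpos
    simp only [eval_neg, neg_lt_zero, neg_pos] at h1 h2
    have := intermediate_value_Ioo' hab.le (f := fun t ↦ p.eval t) p.continuousOn (⟨h2, h1⟩ : (0:ℝ) ∈ Ioo _ _)
    exact this

/-! ### A root of `p` beyond the last critical point -/

/-- Core ray case: `p' > 0` on `(c, ∞)`, `p'(c) = 0`, sign law at `c`, `deg p ≥ 1` ⟹ a root of `p` in `(c, ∞)`.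
[folklore] -/
theorem exists_root_Ioi_of_pos {p : ℝ[X]} {c : ℝ} (hdeg : 0 < p.degree) (hc : (derivative p).eval c = 0)
    (hsc : p.eval c * (derivative (derivative p)).eval c < 0)
    (hpos : ∀ x, c < x → 0 < (derivative p).eval x) : ∃ z, c < z ∧ p.eval z = 0 := by
  have h2c : 0 ≤ (derivative (derivative p)).eval c :=
    derivative_nonneg_of_pos_right _ (lt_add_one c) hc fun x hx ↦ hpos x hx.1
  have hpc : p.eval c < 0 := by by_contra h; push Not at h; nlinarith
  -- `p` is strictly increasing on `[c, ∞)`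
  have hmono : StrictMonoOn (fun t ↦ p.eval t) (Ici c) := by
    refine strictMonoOn_of_deriv_pos (convex_Ici c) p.continuousOn fun x hx ↦ ?_
    rw [interior_Ici] at hx
    rw [Polynomial.deriv]
    exact hpos x hx
  -- `p → +∞` (it cannot tend to `−∞` while increasing)
  have htop : Tendsto (fun t ↦ p.eval t) atTop atTop := by
    rcases le_total 0 p.leadingCoeff with hl | hl
    · exact p.tendsto_atTop_of_leadingCoeff_nonneg hdeg hl
    · exfalso
      have hbot := p.tendsto_atBot_of_leadingCoeff_nonpos hdeg hl
      obtain ⟨x, hx1, hx2⟩ := ((hbot.eventually (eventually_lt_atBot (p.eval c))).and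
        (eventually_gt_atTop c)).exists
      have := hmono (self_mem_Ici) (le_of_lt hx2 : x ∈ Ici c) hx2
      exact lt_irrefl _ (this.trans hx1)
  obtain ⟨x, hx1, hx2⟩ := ((htop.eventually (eventually_gt_atTop 0)).and (eventually_gt_atTop c)).exists
  obtain ⟨z, hz, hz0⟩ := intermediate_value_Ioo hx2.le (f := fun t ↦ p.eval t) p.continuousOn
    (⟨hpc, hx1⟩ : (0:ℝ) ∈ Ioo _ _)
  exact ⟨z, hz.1, hz0⟩

/-- Ray case (either sign of `p'`): last critical point `c`, not a root of `p`, sign law at `c`, no critical point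
beyond ⟹ a root of `p` in `(c, ∞)`. [folklore] -/
theorem exists_root_Ioi {p : ℝ[X]} {c : ℝ} (hdeg : 0 < p.degree) (hc : (derivative p).eval c = 0)
    (hsc : p.eval c * (derivative (derivative p)).eval c < 0)
    (hno : ∀ x, c < x → (derivative p).eval x ≠ 0) : ∃ z, c < z ∧ p.eval z = 0 := by
  rcases pos_or_neg_of_forall_ne_zero (derivative p) ordConnected_Ioi (fun x hx ↦ hno x hx) with hpos | hneg
  · exact exists_root_Ioi_of_pos hdeg hc hsc fun x hx ↦ hpos x hx
  · have hpos : ∀ x, c < x → 0 < (derivative (-p)).eval x := fun x hx ↦ by simpa using hneg x hx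
    have hc' : (derivative (-p)).eval c = 0 := by simpa using hc
    have hsc' : (-p).eval c * (derivative (derivative (-p))).eval c < 0 := by simpa using hsc
    have hdeg' : 0 < (-p).degree := by rwa [degree_neg]
    obtain ⟨z, hz, hz0⟩ := exists_root_Ioi_of_pos hdeg' hc' hsc' hpos
    exact ⟨z, hz, by simpa using hz0⟩

/-- Mirror ray case via `x ↦ −x`: first critical point `c`, not a root, sign law, no critical point before
⟹ a root of `p` in `(−∞, c)`. [folklore] -/
theorem exists_root_Iio {p : ℝ[X]} {c : ℝ} (hdeg : 0 < p.degree) (hc : (derivative p).eval c = 0)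
    (hsc : p.eval c * (derivative (derivative p)).eval c < 0)
    (hno : ∀ x, x < c → (derivative p).eval x ≠ 0) : ∃ z, z < c ∧ p.eval z = 0 := by
  set q : ℝ[X] := p.comp (-X) with hq
  have hqe : ∀ x, q.eval x = p.eval (-x) := fun x ↦ by simp [hq]
  have hq1 : ∀ x, (derivative q).eval x = -((derivative p).eval (-x)) := fun x ↦ by
    simp [hq, derivative_comp]
  have hq2 : ∀ x, (derivative (derivative q)).eval x = (derivative (derivative p)).eval (-x) := fun x ↦ by
    simp [hq, derivative_comp]
  have hdegq : 0 < q.degree := by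
    have hnd : q.natDegree = p.natDegree := by
      rw [hq, natDegree_comp]; simp
    have hp : 0 < p.natDegree := natDegree_pos_iff_degree_pos.2 hdeg
    exact natDegree_pos_iff_degree_pos.1 (hnd ▸ hp)
  have hc' : (derivative q).eval (-c) = 0 := by rw [hq1]; simp [hc]
  have hsc' : q.eval (-c) * (derivative (derivative q)).eval (-c) < 0 := by
    rw [hqe, hq2]; simpa using hsc
  have hno' : ∀ x, -c < x → (derivative q).eval x ≠ 0 := fun x hx ↦ by
    rw [hq1, neg_ne_zero]; exact hno (-x) (by linarith)
  obtain ⟨z, hz, hz0⟩ := exists_root_Ioi hdegq hc' hsc' hno'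
  exact ⟨-z, by linarith, by rwa [hqe] at hz0⟩

/-! ### Counting: the main lemma -/

/-- **JointPoly** (X-4 glue, RH-free): a real polynomial whose derivative is real-rooted and whose critical points off
its zero set all satisfy the strict Laguerre sign law `p·p'' < 0` is real-rooted. [folklore] -/
theorem splits_of_derivative_splits_of_laguerre (p : ℝ[X]) (hd : (derivative p).Splits)
    (hsign : ∀ x : ℝ, (derivative p).eval x = 0 → p.eval x ≠ 0 →
      p.eval x * (derivative (derivative p)).eval x < 0) :
    p.Splits := by
  classical
  -- small degrees split trivially
  by_cases hdeg : p.natDegree ≤ 1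
  · exact Splits.of_natDegree_le_one hdeg
  push Not at hdeg
  have hp0 : p ≠ 0 := by rintro rfl; simp at hdeg
  have hp'0 : derivative p ≠ 0 := by
    intro h
    have := (derivative_eq_zero.1 h : p.natDegree = 0)
    omega
  have hdegpos : 0 < p.degree := natDegree_pos_iff_degree_pos.1 (by omega)
  -- notation: Z = distinct roots of p, C = distinct critical points, C₁ = critical points that are not roots
  set Z : Finset ℝ := p.roots.toFinset with hZ
  set C : Finset ℝ := (derivative p).roots.toFinset with hC
  set C₁ : Finset ℝ := C.filter (fun c ↦ p.eval c ≠ 0) with hC₁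
  have memZ : ∀ x, x ∈ Z ↔ p.eval x = 0 := fun x ↦ by
    rw [hZ, Multiset.mem_toFinset, mem_roots hp0, IsRoot]
  have memC : ∀ x, x ∈ C ↔ (derivative p).eval x = 0 := fun x ↦ by
    rw [hC, Multiset.mem_toFinset, mem_roots hp'0, IsRoot]
  have memC₁ : ∀ x, x ∈ C₁ ↔ (derivative p).eval x = 0 ∧ p.eval x ≠ 0 := fun x ↦ by
    rw [hC₁, Finset.mem_filter, memC]
  -- a bound M beyond every root and every critical point
  obtain ⟨M, hM⟩ : ∃ M : ℝ, 0 < M ∧ (∀ x ∈ Z, |x| < M) ∧ (∀ x ∈ C, |x| < M) := by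
    refine ⟨1 + (Z ∪ C).sum (fun x ↦ |x|), ?_, ?_, ?_⟩
    · have : 0 ≤ (Z ∪ C).sum (fun x ↦ |x|) := Finset.sum_nonneg fun _ _ ↦ abs_nonneg _
      linarith
    · intro x hx
      have : |x| ≤ (Z ∪ C).sum (fun x ↦ |x|) :=
        Finset.single_le_sum (fun _ _ ↦ abs_nonneg _) (Finset.mem_union_left _ hx)
      linarith
    · intro x hx
      have : |x| ≤ (Z ∪ C).sum (fun x ↦ |x|) :=
        Finset.single_le_sum (fun _ _ ↦ abs_nonneg _) (Finset.mem_union_right _ hx)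
      linarith
  obtain ⟨hM0, hMZ, hMC⟩ := hM
  have hMnot : M ∉ C₁ := fun h ↦ by
    have := hMC M (Finset.mem_of_mem_filter _ h); rw [abs_of_pos hM0] at this; exact lt_irrefl _ this
  have hnMnot : -M ∉ C₁ := fun h ↦ by
    have := hMC (-M) (Finset.mem_of_mem_filter _ h); rw [abs_neg, abs_of_pos hM0] at this
    exact lt_irrefl _ this
  have hMne : (-M) ≠ M := by linarith
  -- the interleaving: between consecutive points of S := C₁ ∪ {±M} there is a root of p
  set S : Finset ℝ := insert (-M) (insert M C₁) with hS
  have hScard : S.card = C₁.card + 2 := by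
    rw [hS, Finset.card_insert_of_notMem, Finset.card_insert_of_notMem hMnot]
    rw [Finset.mem_insert, not_or]; exact ⟨hMne, hnMnot⟩
  have key : S.card ≤ (Z \ S).card + 1 := by
    refine Finset.card_le_sdiff_of_interleaved fun x hx y hy hxy hgap ↦ ?_
    -- helper: a critical ROOT strictly between x and y does the job
    by_cases hmid : ∃ c ∈ C, p.eval c = 0 ∧ x < c ∧ c < y
    · obtain ⟨c, -, hc0, hxc, hcy⟩ := hmid
      exact ⟨c, (memZ c).2 hc0, hxc, hcy⟩
    push Not at hmid
    -- otherwise there is NO critical point at all in (x, y)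
    have hnoC : ∀ z, x < z → z < y → (derivative p).eval z ≠ 0 := by
      intro z hxz hzy hz
      by_cases hpz : p.eval z = 0
      · exact absurd (hmid z ((memC z).2 hz) hpz hxz) (not_le.2 hzy)
      · exact hgap z (by rw [hS]; simp [(memC₁ z), hz, hpz]) ⟨hxz, hzy⟩
    -- case analysis on whether x, y are the sentinels ±M
    have hxS := hx; have hyS := hy
    rw [hS, Finset.mem_insert, Finset.mem_insert] at hxS hyS
    -- x = M is impossible (nothing of S lies above M); y = -M impossible likewise
    have hxM : x ≠ M := by
      rintro rfl
      rcases hyS with rfl | rfl | hy1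
      · linarith
      · exact lt_irrefl _ hxy
      · have := hMC y (Finset.mem_of_mem_filter _ hy1); rw [abs_lt] at this; linarith
    have hynM : y ≠ -M := by
      rintro rfl
      rcases hxS with rfl | rfl | hx1
      · exact lt_irrefl _ hxy
      · linarith
      · have := hMC x (Finset.mem_of_mem_filter _ hx1); rw [abs_lt] at this; linarith
    rcases hxS with rfl | rfl | hx1
    · -- x = -M
      rcases hyS with rfl | rfl | hy1
      · exact absurd rfl hynM
      · -- y = M and no critical point in (-M, M): impossible unless C₁ = ∅; then any critical point is a root
        obtain ⟨c, hc⟩ : ∃ c, c ∈ C := by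
          have hcard : (derivative p).roots.card = (derivative p).natDegree := (splits_iff_card_roots.1 hd)
          have hpos : 0 < (derivative p).natDegree := by
            rw [natDegree_derivative]; omega
          have : (derivative p).roots ≠ 0 := by
            intro h0; rw [h0] at hcard; simp at hcard; omega
          obtain ⟨c, hc⟩ := Multiset.exists_mem_of_ne_zero this
          exact ⟨c, Multiset.mem_toFinset.2 hc⟩
        have hcM := hMC c hc; rw [abs_lt] at hcM
        by_cases hpc : p.eval c = 0
        · exact ⟨c, (memZ c).2 hpc, hcM.1, hcM.2⟩
        · exact absurd ((memC c).1 hc) (hnoC c hcM.1 hcM.2)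
      · -- y ∈ C₁ is the first critical point: left ray
        obtain ⟨hy0, hpy⟩ := (memC₁ y).1 hy1
        have hnoL : ∀ z, z < y → (derivative p).eval z ≠ 0 := by
          intro z hzy hz
          have hzC : z ∈ C := (memC z).2 hz
          have hzM := hMC z hzC; rw [abs_lt] at hzM
          exact hnoC z hzM.1 hzy hz
        obtain ⟨z, hzy, hz0⟩ := exists_root_Iio hdegpos hy0 (hsign y hy0 hpy) hnoL
        have hzM := hMZ z ((memZ z).2 hz0); rw [abs_lt] at hzM
        exact ⟨z, (memZ z).2 hz0, hzM.1, hzy⟩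
    · exact absurd rfl hxM
    · -- x ∈ C₁
      obtain ⟨hx0, hpx⟩ := (memC₁ x).1 hx1
      rcases hyS with rfl | rfl | hy1
      · exact absurd rfl hynM
      · -- y = M: right ray
        have hnoR : ∀ z, x < z → (derivative p).eval z ≠ 0 := by
          intro z hxz hz
          have hzC : z ∈ C := (memC z).2 hz
          have hzM := hMC z hzC; rw [abs_lt] at hzM
          exact hnoC z hxz hzM.2 hz
        obtain ⟨z, hxz, hz0⟩ := exists_root_Ioi hdegpos hx0 (hsign x hx0 hpx) hnoR
        have hzM := hMZ z ((memZ z).2 hz0); rw [abs_lt] at hzM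
        exact ⟨z, (memZ z).2 hz0, hxz, hzM.2⟩
      · -- both in C₁: bounded gap
        obtain ⟨hy0, hpy⟩ := (memC₁ y).1 hy1
        obtain ⟨z, hz, hz0⟩ := exists_root_Ioo hxy hx0 hy0 (hsign x hx0 hpx) (hsign y hy0 hpy)
          fun z hz ↦ hnoC z hz.1 hz.2
        exact ⟨z, (memZ z).2 hz0, hz.1, hz.2⟩
  -- hence #Z ≥ #C₁ + 1
  have hZcard : C₁.card + 1 ≤ Z.card := by
    have := Finset.card_le_card (Finset.sdiff_subset (s := Z) (t := S))
    omega
  -- multiplicities: N(p) = Σ_{z ∈ Z} mult_p z, and mult_p z = mult_{p'} z + 1 at every root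
  have hN : p.roots.card = Z.sum (fun z ↦ (derivative p).rootMultiplicity z + 1) := by
    rw [hZ, ← Multiset.toFinset_sum_count_eq]
    refine Finset.sum_congr rfl fun z hz ↦ ?_
    rw [count_roots, derivative_rootMultiplicity_of_root ((memZ z).1 hz)]
    have : 0 < p.rootMultiplicity z := (rootMultiplicity_pos hp0).2 ((memZ z).1 hz)
    omega
  -- N(p') = Σ_{c ∈ C} mult_{p'} c = d - 1, and mult_{p'} c = 1 on C₁
  have hN' : (derivative p).roots.card = C.sum (fun c ↦ (derivative p).rootMultiplicity c) := by
    rw [hC, ← Multiset.toFinset_sum_count_eq]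
    exact Finset.sum_congr rfl fun c _ ↦ by rw [count_roots]
  have hmult1 : ∀ c ∈ C₁, (derivative p).rootMultiplicity c = 1 := by
    intro c hc
    obtain ⟨hc0, hpc⟩ := (memC₁ c).1 hc
    have hpos : 0 < (derivative p).rootMultiplicity c := (rootMultiplicity_pos hp'0).2 hc0
    have h2 : (derivative (derivative p)).eval c ≠ 0 := by
      intro h; have := hsign c hc0 hpc; rw [h, mul_zero] at this; exact lt_irrefl _ this
    have h3 : (derivative (derivative p)).rootMultiplicity c = 0 :=
      rootMultiplicity_eq_zero (by simpa [IsRoot] using h2)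
    have h4 := derivative_rootMultiplicity_of_root (p := derivative p) (t := c) hc0
    omega
  have hsplit' : (derivative p).roots.card = p.natDegree - 1 := by
    rw [splits_iff_card_roots.1 hd, natDegree_derivative]
  -- assemble: N(p) ≥ natDegree p
  have hsumZ : Z.sum (fun z ↦ (derivative p).rootMultiplicity z + 1)
      = Z.sum (fun z ↦ (derivative p).rootMultiplicity z) + Z.card := by
    rw [Finset.sum_add_distrib]; simp
  -- Σ_{z∈Z} mult_{p'} z ≥ Σ_{c ∈ C \ C₁} mult_{p'} c  (C \ C₁ ⊆ Z, terms nonneg)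
  have hsub : C \ C₁ ⊆ Z := by
    intro c hc
    rw [Finset.mem_sdiff] at hc
    have hc0 := (memC c).1 hc.1
    by_contra hz
    exact hc.2 ((memC₁ c).2 ⟨hc0, fun h ↦ hz ((memZ c).2 h)⟩)
  have hge : (C \ C₁).sum (fun c ↦ (derivative p).rootMultiplicity c)
      ≤ Z.sum (fun z ↦ (derivative p).rootMultiplicity z) :=
    Finset.sum_le_sum_of_subset_of_nonneg hsub fun _ _ _ ↦ Nat.zero_le _
  have hCsplit : C.sum (fun c ↦ (derivative p).rootMultiplicity c)
      = (C \ C₁).sum (fun c ↦ (derivative p).rootMultiplicity c) + C₁.card := by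
    have hC₁sub : C₁ ⊆ C := Finset.filter_subset _ _
    rw [← Finset.sum_sdiff hC₁sub, Finset.card_eq_sum_ones, ← Finset.sum_congr rfl hmult1]
  have hNge : p.natDegree ≤ p.roots.card := by
    rw [hN, hsumZ]
    have := hsplit'
    rw [hN', hCsplit] at this
    omega
  exact splits_iff_card_roots.2 (le_antisymm (card_roots' p) hNge)

end Summit.RiemannHypothesis.RiemannHypothesis.Theorems.Splittings.JointPoly
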